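import Summits.Ventures.PercRepro.S1TriangleQ2
import Summits.Ventures.PercRepro.S1FiveCircuitX2C
import Summits.Ventures.PercRepro.S1CellCaps5

/-!
# PercRepro — the cell `(9, 15)` of the `q = 4` window, by LEMMAS Q‴, W′ and X⁺ (p2, gen 18)

The first cell of the row `p = 9`: `n = 24`, nullity `15`. LEMMA Q‴ gives `s₃ ≤ cq2 15 = 49` (the `n`-bound of
LEMMA V, `64`, is too weak here), LEMMA W′ the curve `s₄ ≤ ⌊(12144 − 48·s₃)/8⌋` together with the chain's
`s₄ ≤ fourCircuitBound 15 = 988`, and LEMMA X⁺ the joint bound `s₅ ≤ ⌊(255024 − 1596·s₃ − 16·s₄)/20⌋` for the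
ACTUAL `s₃` and `s₄`. The three-cap cell inequality is certified on a grid: for every `s₃ ≤ 49` and every block
`50k ≤ s₄ < 50(k + 1)` (`k ≤ 19`), `cellOK14 9 15 s₃ (min(min 988 (W′ s₃)) (50(k+1))) (X⁺(s₃, 50k))` — `1000`
kernel cells, each dominating its block (the twin's worst ratio `0.9986`). So the `e`-free cores of rank `9` with
`24` points satisfy `RLS` at level `4`.

* `cell_nine_fifteen_grid` — the `1000` kernel cells;
* **`c025_core_nine_fifteen`** — the core of rank `9` with `24` points.
Axioms: standard.
-/

open scoped Matroid

namespace PercRepro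

namespace S1

open Set

variable {α : Type}

/-- The grid of cells `(9, 15)`: `s₃ ≤ 49`, `s₄` in the block `[50k, 50(k+1))`, `k ≤ 19`. -/
theorem cell_nine_fifteen_grid : ∀ P < 50, ∀ k < 20,
    cellOK14 9 15 P (min (min 988 ((12144 - 48 * P) / 8)) (50 * (k + 1)))
      ((255024 - 1596 * P - 800 * k) / 20) = true := by
  decide +kernel

/-- **THE CELL `(9, 15)`**: an `e`-free core of rank `9` with `24` points satisfies `RLS` at level `4`. -/
theorem c025_core_nine_fifteen (M : Matroid α) [M.Finite] (hR : M.eRank = (9 : ℕ)) (hn : M.E.ncard = 24)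
    (hfree : ∀ e ∈ M.E, ∃ A ⊆ M.E \ {e}, e ∉ M.closure A ∧ e ∉ M.closure ((M.E \ {e}) \ A)) :
    ThmN.RLS M 9 4 := by
  have hd : M.E.encard = M.eRank + ((15 : ℕ) : ℕ∞) := by
    rw [hR, ← M.ground_finite.cast_ncard_eq, hn]
    push_cast
    ring
  -- the triangle cap of LEMMA Q‴
  have hP : {C : Set α | M.IsCircuit C ∧ C.ncard = 3}.ncard ≤ 49 := by
    have h := core_ncard_triangles_le_cq2 M hfree hd
    rwa [show cq2 15 = 49 by decide] at h
  -- the four-circuit caps: the chain's `988` and LEMMA W′'s curve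
  have hfcb : {C : Set α | M.IsCircuit C ∧ C.ncard = 4}.ncard ≤ 988 := by
    have h := ncard_fourCircuits_le_fourCircuitBound M hfree hd
    rwa [show fourCircuitBound 15 = 988 by decide] at h
  have hW := core_eight_mul_ncard_fourCircuits_add_le M hfree
  rw [hn] at hW
  have hS : {C : Set α | M.IsCircuit C ∧ C.ncard = 4}.ncard ≤
      min (min 988 ((12144 - 48 * {C : Set α | M.IsCircuit C ∧ C.ncard = 3}.ncard) / 8))
        (50 * ({C : Set α | M.IsCircuit C ∧ C.ncard = 4}.ncard / 50 + 1)) := by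
    refine le_min (le_min hfcb ?_) ?_
    · rw [Nat.le_div_iff_mul_le (by norm_num)]
      omega
    · have := Nat.lt_mul_div_succ {C : Set α | M.IsCircuit C ∧ C.ncard = 4}.ncard (by norm_num : 0 < 50)
      omega
  -- the five-circuit cap of LEMMA X⁺ on the block
  have hX := core_twenty_mul_ncard_fiveCircuits_add_le M hfree
  rw [hn, show Nat.choose (24 - 3) 2 = 210 by decide, show Nat.choose 24 4 = 10626 by decide] at hX
  have hS5 : {C : Set α | M.IsCircuit C ∧ C.ncard = 5}.ncard ≤
      (255024 - 1596 * {C : Set α | M.IsCircuit C ∧ C.ncard = 3}.ncard -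
        800 * ({C : Set α | M.IsCircuit C ∧ C.ncard = 4}.ncard / 50)) / 20 := by
    rw [Nat.le_div_iff_mul_le (by norm_num)]
    have := Nat.div_mul_le_self {C : Set α | M.IsCircuit C ∧ C.ncard = 4}.ncard 50
    omega
  exact rls_of_cellOK14 M 9 15 _ _ _ (by norm_num) hR hn hfree le_rfl hS hS5 (by norm_num)
    (cell_nine_fifteen_grid _ (by omega) _ (by omega))

end S1

end PercRepro
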